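import Summits.BirchSwinnertonDyer.Rank1Residual.X11b.AnticyclotomicLowerLinksHeegner
import Summits.BirchSwinnertonDyer.Rank1Residual.X11b.AnticyclotomicControlSplitImprimitive
import HarnessLib

/-!
# Class X11b: the Tamagawa relation at a CLASSICAL Heegner field, EXACTLY and for EVERY prime —
# `∏_w c_w(E/K) = (∏_ℓ c_ℓ(E))²` and `∏_{w∣N⁺} c_w(E/K) = ∏_w c_w(E/K)` (cell `b2b-bsdres`,
# sub-cell `multr1-p2`, gen 18)

HONEST FRAMING (verbatim, cell `b2b-bsdres`, run/shared/lean/b2b/bsd-rank1-residual/): the goal of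
the cell is to DELETE the COMBINATION-SHAPED residual classes for ALL analytic-rank `≤ 1` curves
over `ℚ` — "full BSD formula for every rank `≤ 1` curve in class `C`" assembled STRICTLY from
published theorems — so that the rank-`≤ 1` remainder becomes exactly the CONSTRUCTION-SHAPED
classes, which are TYPED (missing-input Props), NOT attempted; this is not "finishing BSD".
Research route `p2` for class X11b; no claim beyond the stated class and loci; nothing booked;
X11b stays CONSTRUCTION-SHAPED. THEOREMS ONLY (no definition, no named fact, no `sorry`).

## What this file does

Jetchev–Skinner–Wan 2017 §7.3.1 (eq:tamK) at a CLASSICAL Heegner field `K` (imaginary quadratic,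
every prime `ℓ ∣ N_E` SPLIT in `K`): "`∏_w c_w(E/K) = ∏_ℓ c_ℓ(E/ℚ)²`". The sibling sub-cell
(`TamagawaQuadraticPlaces/BaseChange.lean`, `AnticyclotomicTamagawa.lean`) proved the `p`-adic
valuations of this identity for `p ≥ 5` at ANY quadratic field with a bad-prime hypothesis, through
the twist `E^{(d_K)}` (whose additive fibres at the primes of `d_K` have `c ≤ 4 < p`). At a Heegner
field no twist and no bound on `p` is needed: a place `w` of `K` over a bad `ℓ` is one of the two
degree-one places over a split prime (`c_w = c_ℓ(E)`), and a place over a good `ℓ` — split, inert or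
ramified — is a place of good reduction of `E_K` (`c_w = 1`). Hence, as EXACT identities of natural
numbers:

* `prod_fibre_localTamagawaNumber_eq_sq_of_heegner` — `∏_{w ∣ v} c_w(E/K) = c_v(E)²` for every
  finite place `v` of `ℚ`;
* `tamagawaProduct_baseChange_eq_sq_of_heegner` — **`∏_w c_w(E/K) = (∏_ℓ c_ℓ(E))²`** (eq:tamK);
* `tamagawaProductSplit_eq_tamagawaProduct_of_heegner` — `∏_{w ∣ N⁺} c_w(E/K) = ∏_w c_w(E/K)`
  (Cas18 Thm. 2.3's Tamagawa term IS the full product: every bad prime is in `N⁺`);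
* `padicValNat_tamagawaProductSplit_eq_of_heegner_prime`, `padicValNat_tamagawaProduct_baseChange_of_heegner_prime`
  — the two valuation identities used by the route's STEP L chain
  (`indexLowerBoundAt_of_onTree[Upper|Lower]Links_of_heegner`), now for EVERY prime `p` (the
  sibling's `padicValNat_tamagawaProductSplit_eq_of_heegner` / multr1-p2's
  `padicValNat_tamagawaProduct_baseChange_of_heegner` carry `5 ≤ p` only through the proof).

Purpose: the `p ≥ 5` hypothesis of the on-tree reading of STEP L was an artefact of the Tamagawa
bookkeeping; with this file the route's tree-object chain (control `≤` + open input ⟹ STEP L) is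
available at `p = 3` as well (`BDPRouteOddOnTree.lean`). Bookkeeping; nothing booked.

References: [JetchevSkinnerWan2017] §7.3.1 (eq:tamK) (arXiv:1512.06894 p. 28); [Castella2018]
Thm. 2.3 (arXiv:1704.06608 p. 5), the term `∏_{w∣N⁺}`; [SilvermanAEC2009] VII.6.1 (Kodaira–Néron),
VII.6 Ex. 7.6 (invariance of `c` under unramified degree-one base change); [GrossZagier1986] I §3
(the Heegner hypothesis).
-/

noncomputable section

open scoped Classical

open WeierstrassCurve NumberField IsDedekindDomain Literature.NumberTheory.EllipticCurves
  Literature.NumberTheory.EllipticCurves.Rank1Residual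

namespace Summit.BirchSwinnertonDyer.Rank1Residual.X11b

section Heegner

variable (W : WeierstrassCurve ℚ) [W.IsElliptic] (K : Type) [Field K] [NumberField K]

/-- **At a classical Heegner field, a place of `K` over a GOOD prime of `E` is a place of good
reduction of `E_K`, so `c_w(E/K) = 1`.** (Any prime over which `K` is not split-with-`ℓ ∣ N`: by
the Heegner hypothesis such an `ℓ` does not divide `N_E`.) [cite: SilvermanAEC2009, VII.5.1(a) and VII.6.1] -/
theorem localTamagawaNumber_baseChange_eq_one_of_not_dvd
    (w : HeightOneSpectrum (𝓞 K)) {N : ℕ} (hN : W.conductorNorm ℤ = N)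
    (hℓN : ¬ ((Rat.HeightOneSpectrum.primesEquiv (w.under (𝓞 ℚ)) : ℕ) : ℕ) ∣ N) :
    ((W.baseChange K).baseChange (w.adicCompletion K)).localTamagawaNumber
        (w.adicCompletionIntegers K) = 1 := by
  haveI hEK : (W.baseChange K).IsElliptic := by rw [baseChange]; infer_instance
  have hgw : (W.baseChange K).HasGoodReductionAt w := by
    by_contra hbad
    exact hℓN (hN ▸ primesEquiv_under_dvd_conductorNorm_of_not_hasGoodReductionAt (W := W) K w hbad)
  exact localTamagawaNumber_eq_one_of_good' w (W.baseChange K)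
    (WeierstrassCurve.localTamagawaNumber_eq_one_of_hasGoodReduction_holds _ _) hgw

/-- **The fibre identity at a classical Heegner field, EXACT and for every prime: `∏_{w ∣ v} c_w(E/K)
= c_v(E)²`** for every finite place `v` of `ℚ`. Split `v` (in particular every bad `v`, by the
Heegner hypothesis): two places of degree one, each with `c_w = c_v(E)`
(`localTamagawaNumber_baseChange_eq_of_degree_one`). Non-split `v`: one place `w`; `ℓ ∤ N_E`, so
`c_v(E) = 1` and `c_w(E/K) = 1` (`localTamagawaNumber_baseChange_eq_one_of_not_dvd`).
[cite: JetchevSkinnerWan2017, §7.3.1 (eq:tamK) (arXiv:1512.06894 p. 28)] [cite: SilvermanAEC2009, VII.6.1 and Ex. 7.6] -/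
theorem prod_fibre_localTamagawaNumber_eq_sq_of_heegner (h2 : Module.finrank ℚ K = 2) {N : ℕ}
    (hN : W.conductorNorm ℤ = N) (hH : SatisfiesHeegnerHypothesis N K)
    (v : HeightOneSpectrum (𝓞 ℚ)) :
    (∏ w ∈ (HeightOneSpectrum.finite_setOf_under_eq_of_numberField (K := K) v).toFinset,
        ((W.baseChange K).baseChange (w.adicCompletion K)).localTamagawaNumber
          (w.adicCompletionIntegers K)) =
      ((W.baseChange (v.adicCompletion ℚ)).localTamagawaNumber (v.adicCompletionIntegers ℚ)) ^ 2 := by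
  set ℓ : ℕ := (Rat.HeightOneSpectrum.primesEquiv v : ℕ) with hℓdef
  haveI hℓ : Fact ℓ.Prime := ⟨(Rat.HeightOneSpectrum.primesEquiv v).2⟩
  have hvℓ : (Rat.HeightOneSpectrum.primesEquiv v : ℕ) = ℓ := rfl
  have hfin := HeightOneSpectrum.finite_setOf_under_eq_of_numberField (K := K) v
  -- the case of a single place `w` above `v` (inert or ramified): `ℓ ∤ N`, both numbers are `1`
  have key : ∀ w : HeightOneSpectrum (𝓞 K),
      {w' : HeightOneSpectrum (𝓞 K) | w'.under (𝓞 ℚ) = v} = {w} →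
      (∏ w ∈ hfin.toFinset,
          ((W.baseChange K).baseChange (w.adicCompletion K)).localTamagawaNumber
            (w.adicCompletionIntegers K)) =
        ((W.baseChange (v.adicCompletion ℚ)).localTamagawaNumber (v.adicCompletionIntegers ℚ)) ^ 2 := by
    intro w hset
    have hw : w.under (𝓞 ℚ) = v := by
      have h : w ∈ ({w} : Set (HeightOneSpectrum (𝓞 K))) := Set.mem_singleton _
      rwa [← hset] at h
    have hF : hfin.toFinset = {w} := by
      ext w'
      rw [Set.Finite.mem_toFinset, hset]
      simp
    -- `ℓ` does not split in `K`, hence (Heegner) `ℓ ∤ N`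
    have hns : ¬ SplitsIn K ℓ := by
      show ((Ideal.span {(ℓ : ℤ)}).primesOver (𝓞 K)).ncard ≠ 2
      rw [hℓdef, ncard_primesOver_span_eq K v, hset, Set.ncard_singleton]
      decide
    have hℓN : ¬ ℓ ∣ N := fun h ↦ hns (hH ℓ hℓ.out h)
    -- `c_v(E) = 1`
    have hgood : W.HasGoodReductionAt v :=
      (hasGoodReductionAtPrime_primesEquiv_iff_holds W v ℓ hvℓ).mp
        (by
          by_contra hbad'
          exact hℓN (hN ▸ (W.dvd_conductorNorm_iff_not_hasGoodReductionAtPrime ℓ).mpr hbad'))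
    have h1 : (W.baseChange (v.adicCompletion ℚ)).localTamagawaNumber (v.adicCompletionIntegers ℚ)
        = 1 := W.localTamagawaNumber_eq_one_of_hasGoodReductionAt_holds v hgood
    -- `c_w(E/K) = 1`
    have hℓN' : ¬ ((Rat.HeightOneSpectrum.primesEquiv (w.under (𝓞 ℚ)) : ℕ) : ℕ) ∣ N := by
      rw [hw, hvℓ]; exact hℓN
    rw [hF, Finset.prod_singleton, localTamagawaNumber_baseChange_eq_one_of_not_dvd W K w hN hℓN',
      h1]
    norm_num
  rcases placesOver_trichotomy_of_finrank_eq_two K h2 v with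
    ⟨w₁, w₂, hne, hset, hef⟩ | ⟨w, hset, -, -⟩ | ⟨w, hset, -, -⟩
  · -- split: two places of degree one
    have hw₁ : w₁.under (𝓞 ℚ) = v := by
      have h : w₁ ∈ ({w₁, w₂} : Set (HeightOneSpectrum (𝓞 K))) := Set.mem_insert _ _
      rwa [← hset] at h
    have hw₂ : w₂.under (𝓞 ℚ) = v := by
      have h : w₂ ∈ ({w₁, w₂} : Set (HeightOneSpectrum (𝓞 K))) :=
        Set.mem_insert_of_mem _ (Set.mem_singleton _)
      rwa [← hset] at h
    obtain ⟨he₁, hf₁⟩ := hef w₁ hw₁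
    obtain ⟨he₂, hf₂⟩ := hef w₂ hw₂
    have hF : hfin.toFinset = {w₁, w₂} := by
      ext w
      rw [Set.Finite.mem_toFinset, hset]
      simp
    have c₁ := localTamagawaNumber_baseChange_eq_of_degree_one W w₁ he₁ hf₁
    have c₂ := localTamagawaNumber_baseChange_eq_of_degree_one W w₂ he₂ hf₂
    rw [hw₁] at c₁
    rw [hw₂] at c₂
    rw [hF, Finset.prod_pair hne, c₁, c₂, sq]
  · exact key w hset
  · exact key w hset

/-- **Jetchev–Skinner–Wan (eq:tamK), EXACT: `∏_w c_w(E/K) = (∏_ℓ c_ℓ(E))²` at a classical Heegner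
field** (`K` quadratic, every `ℓ ∣ N_E` split), for every globally minimal elliptic `W/ℚ` — no
hypothesis on any prime. Proof: both Tamagawa products are finite products; regroup the places of
`K` along the finite fibres of `w ↦ w ∩ ℤ` (`Finset.prod_fiberwise_of_maps_to`) and use the fibre
identity `prod_fibre_localTamagawaNumber_eq_sq_of_heegner`.
[cite: JetchevSkinnerWan2017, §7.3.1 (eq:tamK) (arXiv:1512.06894 p. 28)] -/
theorem tamagawaProduct_baseChange_eq_sq_of_heegner (h2 : Module.finrank ℚ K = 2) {N : ℕ}
    (hN : W.conductorNorm ℤ = N) (hH : SatisfiesHeegnerHypothesis N K) :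
    (W.baseChange K).tamagawaProduct = W.tamagawaProduct ^ 2 := by
  haveI hEK : (W.baseChange K).IsElliptic := by rw [baseChange]; infer_instance
  -- the two local Tamagawa functions
  set cK : HeightOneSpectrum (𝓞 K) → ℕ := fun w =>
    ((W.baseChange K).baseChange (w.adicCompletion K)).localTamagawaNumber
      (w.adicCompletionIntegers K) with hcK
  set cQ : HeightOneSpectrum (𝓞 ℚ) → ℕ := fun v =>
    (W.baseChange (v.adicCompletion ℚ)).localTamagawaNumber (v.adicCompletionIntegers ℚ) with hcQ
  have hfinK : (Function.mulSupport cK).Finite :=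
    (W.baseChange K).mulSupport_localTamagawaNumber_finite_holds
  have hfinQ : (Function.mulSupport cQ).Finite := W.mulSupport_localTamagawaNumber_finite_holds
  -- fibres of `K → ℚ` on places and the finite index sets
  set F : HeightOneSpectrum (𝓞 ℚ) → Finset (HeightOneSpectrum (𝓞 K)) := fun v =>
    (HeightOneSpectrum.finite_setOf_under_eq_of_numberField (K := K) v).toFinset with hF
  have hmemF : ∀ v w, w ∈ F v ↔ w.under (𝓞 ℚ) = v := fun v w => by
    simp [hF, Set.Finite.mem_toFinset]
  set SQ : Finset (HeightOneSpectrum (𝓞 ℚ)) :=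
    hfinK.toFinset.image (fun w => w.under (𝓞 ℚ)) ∪ hfinQ.toFinset with hSQ
  set SK : Finset (HeightOneSpectrum (𝓞 K)) := SQ.biUnion F with hSK
  have hsubK : Function.mulSupport cK ⊆ ↑SK := by
    intro w hw
    rw [Finset.mem_coe, hSK, Finset.mem_biUnion]
    refine ⟨w.under (𝓞 ℚ), ?_, (hmemF _ _).mpr rfl⟩
    rw [hSQ, Finset.mem_union, Finset.mem_image]
    exact Or.inl ⟨w, hfinK.mem_toFinset.mpr hw, rfl⟩
  have hsubQ : Function.mulSupport cQ ⊆ ↑SQ := fun v hv => by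
    rw [Finset.mem_coe, hSQ, Finset.mem_union]
    exact Or.inr (hfinQ.mem_toFinset.mpr hv)
  -- the two products as finite products over the index sets
  have hK' : (W.baseChange K).tamagawaProduct = ∏ w ∈ SK, cK w := by
    rw [show (W.baseChange K).tamagawaProduct = ∏ᶠ w, cK w from rfl,
      finprod_eq_prod_of_mulSupport_subset cK hsubK]
  have hQ' : W.tamagawaProduct = ∏ v ∈ SQ, cQ v := by
    rw [show W.tamagawaProduct = ∏ᶠ v, cQ v from rfl,
      finprod_eq_prod_of_mulSupport_subset cQ hsubQ]
  -- regroup the `K`-side along the fibres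
  have hmaps : ∀ w ∈ SK, w.under (𝓞 ℚ) ∈ SQ := by
    intro w hw
    rw [hSK, Finset.mem_biUnion] at hw
    obtain ⟨v, hv, hwv⟩ := hw
    rwa [(hmemF v w).mp hwv]
  have hfib : ∀ v ∈ SQ, SK.filter (fun w => w.under (𝓞 ℚ) = v) = F v := by
    intro v hv
    ext w
    simp only [Finset.mem_filter, hmemF]
    constructor
    · exact fun h => h.2
    · intro h
      refine ⟨?_, h⟩
      rw [hSK, Finset.mem_biUnion]
      exact ⟨v, hv, (hmemF v w).mpr h⟩
  rw [hK', hQ', ← Finset.prod_fiberwise_of_maps_to hmaps, ← Finset.prod_pow]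
  refine Finset.prod_congr rfl fun v hv => ?_
  rw [hfib v hv]
  exact prod_fibre_localTamagawaNumber_eq_sq_of_heegner W K h2 hN hH v

/-- **At a classical Heegner field the `N⁺`-Tamagawa product of Cas18 Thm. 2.3 IS the full Tamagawa
product of `E/K`: `∏_{w ∣ N⁺} c_w(E/K) = ∏_w c_w(E/K)`, exactly.** Every bad prime of `E` splits in
`K`, so the places off `N⁺` lie over good primes, where `c_w = 1`
(`localTamagawaNumber_baseChange_eq_one_of_not_dvd`). No hypothesis on any prime.
[cite: Castella2018, Thm. 2.3 (arXiv:1704.06608 p. 5), the term ∏_{w∣N⁺}] [cite: JetchevSkinnerWan2017, §7.3.1 (eq:tamK)] -/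
theorem tamagawaProductSplit_eq_tamagawaProduct_of_heegner {N : ℕ} (hN : W.conductorNorm ℤ = N)
    (hH : SatisfiesHeegnerHypothesis N K) :
    tamagawaProductSplit W K = (W.baseChange K).tamagawaProduct := by
  show (∏ᶠ w : HeightOneSpectrum (𝓞 K),
      if IsPlaceOverSplitConductorPrime W K w then
        ((W.baseChange K).baseChange (w.adicCompletion K)).localTamagawaNumber
          (w.adicCompletionIntegers K)
      else 1) =
    ∏ᶠ w : HeightOneSpectrum (𝓞 K),
      ((W.baseChange K).baseChange (w.adicCompletion K)).localTamagawaNumber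
        (w.adicCompletionIntegers K)
  refine finprod_congr fun w ↦ ?_
  by_cases hcond : IsPlaceOverSplitConductorPrime W K w
  · rw [if_pos hcond]
  · rw [if_neg hcond]
    set ℓ : ℕ := (Rat.HeightOneSpectrum.primesEquiv (w.under (𝓞 ℚ)) : ℕ) with hℓdef
    haveI hℓ : Fact ℓ.Prime := ⟨(Rat.HeightOneSpectrum.primesEquiv (w.under (𝓞 ℚ))).2⟩
    have hℓN : ¬ ℓ ∣ N := by
      intro h
      exact hcond ⟨hH ℓ hℓ.out h, hN ▸ h⟩
    exact (localTamagawaNumber_baseChange_eq_one_of_not_dvd W K w hN hℓN).symm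

variable (p : ℕ) [Fact p.Prime]

omit [Fact p.Prime] in
/-- **(TAM) at a classical Heegner field for EVERY prime `p`**:
`ord_p ∏_{w∣N⁺} c_w(E/K) = ord_p ∏_w c_w(E/K)` (any number field `K` in which every prime of `N_E`
has exactly two primes above it — the Heegner hypothesis as typed). The sibling's
`padicValNat_tamagawaProductSplit_eq_of_heegner` without its `5 ≤ p` (and without `[K:ℚ] = 2`).
[cite: JetchevSkinnerWan2017, §7.3.1 (eq:tamK)] [cite: Castella2018, Thm. 2.3 (arXiv:1704.06608 p. 5), the term ∏_{w∣N⁺}] -/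
theorem padicValNat_tamagawaProductSplit_eq_of_heegner_prime
    {N : ℕ} (hN : W.conductorNorm ℤ = N) (hH : SatisfiesHeegnerHypothesis N K) :
    padicValNat p (tamagawaProductSplit W K) = padicValNat p (W.baseChange K).tamagawaProduct := by
  rw [tamagawaProductSplit_eq_tamagawaProduct_of_heegner W K hN hH]

/-- **`ord_p ∏_w c_w(E/K) = 2 · ord_p ∏_ℓ c_ℓ(E)` at a classical Heegner field for EVERY prime `p`**
(multr1-p2's `padicValNat_tamagawaProduct_baseChange_of_heegner` without its `5 ≤ p`), from the exact
identity `tamagawaProduct_baseChange_eq_sq_of_heegner`. [cite: JetchevSkinnerWan2017, §7.3.1 (eq:tamK)] -/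
theorem padicValNat_tamagawaProduct_baseChange_of_heegner_prime (hK : IsImaginaryQuadratic K)
    {N : ℕ} (hN : W.conductorNorm ℤ = N) (hH : SatisfiesHeegnerHypothesis N K) :
    padicValNat p (W.baseChange K).tamagawaProduct = 2 * padicValNat p W.tamagawaProduct := by
  rw [tamagawaProduct_baseChange_eq_sq_of_heegner W K hK.1 hN hH, padicValNat.pow]

end Heegner

end Summit.BirchSwinnertonDyer.Rank1Residual.X11b

end
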